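import Summits.BirchSwinnertonDyer.BirchSwinnertonDyer.Theorems.ByReductionTypeAtTwoMultTransportArchReal
import HarnessLib

/-!
# Congruence transport at `p = 2` for IRREDUCIBLE `E[2]` with `Δ_E > 0`, leg (P1): REAL-ROOT CERTIFICATES —
# a real root of the `2`-division cubic, the least-root window, and a rational bound for the root map on
# an interval

Cell `bsd-2adic` (run/shared/lean/pub/bsd-2adic/), seat `bsd-2adic-mult-3` (GEN 14), road «μ = 0 by mod-2
CONGRUENCE TRANSPORT» (RC-167) extended to the `Δ > 0` targets left NOT COVERED by GEN 13 (the archimedean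
line `C_∞[2] = ⟨T₃⟩`, `T₃` = the point of LEAST real abscissa, must be matched by the residual isomorphism:
Matsuno 2008 Thm. 4.2, `v ∈ Σ_+`). HONEST FRAMING: research route; THEOREMS ONLY (elementary real algebra;
no `def`, no named fact, no `sorry`); nothing booked; BSD is not proved by any of this. PARTITION: X5@2
multiplicative, `E[2]`-irreducible no-file classes with `Δ > 0` (K4ᵐ, RESIDUAL-MAP B1·O1) × `p = 2` —
types-the-object-of (the decidable archimedean certificate of the class files); bears_on K4 items 19922 /
19923 (`--supports stmt-BirchSwinnertonDyer-19923`).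

## What (pure real algebra; the per-class hypotheses are rational inequalities decided by `norm_num`)

* §1 `exists_root_fourCubic` — every real cubic `4X³ + aX² + bX + c` has a real root (intermediate value
  theorem on `[-R, R]`, `R = 1 + |a| + |b| + |c|`); `exists_ordered_splitTwoTorsion_real_of_Δ_pos` — for
  `V/ℝ` with `Δ > 0` the `2`-division cubic splits with THREE ORDERED real roots `e₃ < e₂ < e₁` (no rational
  root assumed; t42's `exists_ordered_splitTwoTorsion_real` fed with the IVT root).
* §2 THE LEAST-ROOT WINDOW: `lt_and_lt_of_fourCubic_pos` — if `ψ(m) > 0` and `12m + b₂ < 0` (i.e. `m` is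
  left of the mean of the roots) then `e₃ < m < e₂`; `lt_leastRoot_of_fourCubic_neg` — if moreover
  `ψ(ℓ) < 0` and `ℓ < m` then `ℓ < e₃`. So rationals `ℓ < m` with `ψ(ℓ) < 0 < ψ(m)`, `12m + b₂ < 0` ENCLOSE
  the least root and separate it from the other two; `eq_leastRoot_of_root_of_lt` — a root `< m` IS `e₃`.
* §3 THE ROOT MAP ON THE WINDOW: `affine_lt_of_mem_Ioo`, `quad_lt_of_mem_Ioo_of_nonneg`,
  `quad_lt_of_mem_Ioo_of_nonpos` — for `t ∈ (ℓ, m)`, `q₀ + q₁t + q₂t² < M` from two RATIONAL endpoint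
  inequalities (the chord above a convex parabola, resp. the tangent-at-midpoint bound for a concave one).
  With §2 on both curves this certifies "`q` maps the least root of `ψ_{E′}` to the least root of `ψ_E`",
  i.e. `θ(T₃′) = T₃` (mult-3 GEN 12's `lineInfok` column, now a kernel-checkable certificate).

References: [Matsuno2008] Thm. 4.2 (p. 413: `φ(C_{E,v}[p]) = C_{E′,v}[p]` for `v ∈ Σ_+`), Prop. 4.4;
[GreenbergLNM1716] §5 p. 168 and Remark p. 174 (`C_∞` generated by the point of minimal abscissa);
[SilvermanAEC2009] III.1, Prop. X.1.4.
-/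

set_option autoImplicit false
set_option linter.dupNamespace false

noncomputable section

namespace Summit.BirchSwinnertonDyer.BirchSwinnertonDyer.Theorems.MultIrredTransportAtTwo

open WeierstrassCurve Literature.NumberTheory.EllipticCurves
  Summit.BirchSwinnertonDyer.BirchSwinnertonDyer.Theorems.MultTransportAtTwo

/-! ## §1. A real root; three ordered real roots from `Δ > 0` alone -/

/-- **Every real cubic `4X³ + aX² + bX + c` has a real root** (intermediate value theorem on `[-R, R]`,
`R = 1 + |a| + |b| + |c|`: the cubic is `≤ -R²(3R+1) < 0` at `-R` and `≥ R²(3R+1) > 0` at `R`). [folklore] -/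
theorem exists_root_fourCubic (a b c : ℝ) : ∃ x : ℝ, 4 * x ^ 3 + a * x ^ 2 + b * x + c = 0 := by
  set R : ℝ := 1 + |a| + |b| + |c| with hR
  have hR1 : 1 ≤ R := by
    rw [hR]; linarith [abs_nonneg a, abs_nonneg b, abs_nonneg c]
  have hR0 : 0 ≤ R := zero_le_one.trans hR1
  set f : ℝ → ℝ := fun x ↦ 4 * x ^ 3 + a * x ^ 2 + b * x + c with hf
  have hcont : Continuous f := by rw [hf]; fun_prop
  have ha := le_abs_self a; have ha' := neg_abs_le a
  have hb := le_abs_self b; have hb' := neg_abs_le b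
  have hc := le_abs_self c; have hc' := neg_abs_le c
  have hR2 : 0 ≤ R ^ 2 := sq_nonneg R
  have hbR : |b| * R ≤ |b| * R ^ 2 := by
    apply mul_le_mul_of_nonneg_left _ (abs_nonneg b); nlinarith
  have hcR : |c| ≤ |c| * R ^ 2 := by
    have : (1 : ℝ) ≤ R ^ 2 := by nlinarith
    nlinarith [abs_nonneg c]
  have hpos : 0 ≤ f R := by
    have h1 : -|a| * R ^ 2 ≤ a * R ^ 2 := by nlinarith
    have h2 : -|b| * R ≤ b * R := by nlinarith
    have h3 : 4 * R ^ 3 - |a| * R ^ 2 - |b| * R ^ 2 - |c| * R ^ 2 = R ^ 2 * (3 * R + 1) := by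
      rw [hR]; ring
    have h4 : 0 ≤ R ^ 2 * (3 * R + 1) := by positivity
    show 0 ≤ 4 * R ^ 3 + a * R ^ 2 + b * R + c
    linarith
  have hneg : f (-R) ≤ 0 := by
    have h1 : a * R ^ 2 ≤ |a| * R ^ 2 := by nlinarith
    have h2 : -(b * R) ≤ |b| * R := by nlinarith
    have h3 : -4 * R ^ 3 + |a| * R ^ 2 + |b| * R ^ 2 + |c| * R ^ 2 = -(R ^ 2 * (3 * R + 1)) := by
      rw [hR]; ring
    have h4 : 0 ≤ R ^ 2 * (3 * R + 1) := by positivity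
    show 4 * (-R) ^ 3 + a * (-R) ^ 2 + b * (-R) + c ≤ 0
    have : (-R) ^ 3 = -R ^ 3 := by ring
    have : (-R) ^ 2 = R ^ 2 := by ring
    nlinarith
  have hsub := intermediate_value_Icc (show -R ≤ R by linarith) hcont.continuousOn
  obtain ⟨x, -, hx⟩ := hsub ⟨hneg, hpos⟩
  exact ⟨x, hx⟩

/-- **`Δ > 0` alone gives three ORDERED real roots** `e₃ < e₂ < e₁` of the `2`-division cubic of `V/ℝ`
(`SplitTwoTorsion V e₁ e₂ e₃`); no rational root is assumed — the `E[2]`-irreducible companion of t42's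
`exists_ordered_splitTwoTorsion_real`. [cite: SilvermanAEC2009, III.1 and Prop. X.1.4] -/
theorem exists_ordered_splitTwoTorsion_real_of_Δ_pos (V : WeierstrassCurve ℝ) (hΔ : 0 < V.Δ) :
    ∃ e₁ e₂ e₃ : ℝ, e₃ < e₂ ∧ e₂ < e₁ ∧ V.toAffine.SplitTwoTorsion e₁ e₂ e₃ := by
  obtain ⟨x, hx⟩ := exists_root_fourCubic V.b₂ (2 * V.b₄) V.b₆
  obtain ⟨e₁, e₂, e₃, h₂₃, h₁₂, hsplit, -⟩ :=
    exists_ordered_splitTwoTorsion_real V (x := x) (by linear_combination hx) hΔ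
  exact ⟨e₁, e₂, e₃, h₂₃, h₁₂, hsplit⟩

/-! ## §2. The least-root window -/

section Window

variable {V : Affine ℝ} {e₁ e₂ e₃ : ℝ}

/-- **The least-root window**: for the split real cubic `ψ = 4(X−e₁)(X−e₂)(X−e₃)`, `e₃ < e₂ < e₁`, a real
`m` with `ψ(m) > 0` and `12m + b₂ < 0` (`m` lies left of the mean `(e₁+e₂+e₃)/3 = −b₂/12`, hence left of
`e₁`) satisfies `e₃ < m < e₂` (`ψ > 0` exactly on `(e₃,e₂) ∪ (e₁,∞)`). [cite: SilvermanAEC2009, Prop. X.1.4] -/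
theorem lt_and_lt_of_fourCubic_pos (h : V.SplitTwoTorsion e₁ e₂ e₃) (h₂₃ : e₃ < e₂) (h₁₂ : e₂ < e₁)
    {m : ℝ} (hm : 0 < 4 * m ^ 3 + V.b₂ * m ^ 2 + 2 * V.b₄ * m + V.b₆) (hm' : 12 * m + V.b₂ < 0) :
    e₃ < m ∧ m < e₂ := by
  rw [fourCubic_eq_of_splitTwoTorsion h] at hm
  have hb₂ := h.b₂_eq
  have h1 : m - e₁ < 0 := by rw [hb₂] at hm'; linarith
  have hprod : 0 < (m - e₁) * (m - e₂) * (m - e₃) := by linarith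
  constructor
  · by_contra hle
    rw [not_lt] at hle
    have h2 : m - e₂ < 0 := by linarith
    have h12 : 0 < (m - e₁) * (m - e₂) := mul_pos_of_neg_of_neg h1 h2
    have : (m - e₁) * (m - e₂) * (m - e₃) ≤ 0 := mul_nonpos_iff.2 (Or.inl ⟨h12.le, by linarith⟩)
    linarith
  · by_contra hle
    rw [not_lt] at hle
    have h12 : (m - e₁) * (m - e₂) ≤ 0 := mul_nonpos_iff.2 (Or.inr ⟨h1.le, by linarith⟩)
    have : (m - e₁) * (m - e₂) * (m - e₃) ≤ 0 := mul_nonpos_iff.2 (Or.inr ⟨h12, by linarith⟩)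
    linarith

/-- **Below the window lies only `e₃`**: if `ψ(ℓ) < 0` and `ℓ < e₂` then `ℓ < e₃` (`ψ < 0` exactly on
`(−∞,e₃) ∪ (e₂,e₁)`). [cite: SilvermanAEC2009, Prop. X.1.4] -/
theorem lt_leastRoot_of_fourCubic_neg (h : V.SplitTwoTorsion e₁ e₂ e₃) (h₁₂ : e₂ < e₁)
    {ℓ : ℝ} (hℓ : 4 * ℓ ^ 3 + V.b₂ * ℓ ^ 2 + 2 * V.b₄ * ℓ + V.b₆ < 0) (hℓ2 : ℓ < e₂) : ℓ < e₃ := by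
  rw [fourCubic_eq_of_splitTwoTorsion h] at hℓ
  have h12 : 0 < (ℓ - e₁) * (ℓ - e₂) := mul_pos_of_neg_of_neg (by linarith) (by linarith)
  by_contra hle
  rw [not_lt] at hle
  have : 0 ≤ (ℓ - e₁) * (ℓ - e₂) * (ℓ - e₃) := mul_nonneg h12.le (by linarith)
  linarith

/-- **A root below the window is the least root**: if `r` is a root of `ψ` and `r < m` with `m` in the
window (`ψ(m) > 0`, `12m + b₂ < 0`), then `r = e₃`. [cite: SilvermanAEC2009, Prop. X.1.4] -/
theorem eq_leastRoot_of_root_of_lt (h : V.SplitTwoTorsion e₁ e₂ e₃) (h₂₃ : e₃ < e₂) (h₁₂ : e₂ < e₁)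
    {m r : ℝ} (hm : 0 < 4 * m ^ 3 + V.b₂ * m ^ 2 + 2 * V.b₄ * m + V.b₆) (hm' : 12 * m + V.b₂ < 0)
    (hr : 4 * r ^ 3 + V.b₂ * r ^ 2 + 2 * V.b₄ * r + V.b₆ = 0) (hrm : r < m) : r = e₃ := by
  obtain ⟨-, hm2⟩ := lt_and_lt_of_fourCubic_pos h h₂₃ h₁₂ hm hm'
  rcases eq_or_eq_or_eq_of_root h hr with rfl | rfl | rfl
  · linarith
  · linarith
  · rfl

/-- **The least root lies in the window `(ℓ, m)`** given the rational certificate `ψ(ℓ) < 0 < ψ(m)`,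
`ℓ < m`, `12m + b₂ < 0`. [cite: SilvermanAEC2009, Prop. X.1.4] -/
theorem leastRoot_mem_Ioo_of_cert (h : V.SplitTwoTorsion e₁ e₂ e₃) (h₂₃ : e₃ < e₂) (h₁₂ : e₂ < e₁)
    {ℓ m : ℝ} (hℓ : 4 * ℓ ^ 3 + V.b₂ * ℓ ^ 2 + 2 * V.b₄ * ℓ + V.b₆ < 0)
    (hm : 0 < 4 * m ^ 3 + V.b₂ * m ^ 2 + 2 * V.b₄ * m + V.b₆) (hℓm : ℓ < m) (hm' : 12 * m + V.b₂ < 0) :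
    ℓ < e₃ ∧ e₃ < m := by
  obtain ⟨hm3, hm2⟩ := lt_and_lt_of_fourCubic_pos h h₂₃ h₁₂ hm hm'
  exact ⟨lt_leastRoot_of_fourCubic_neg h h₁₂ hℓ (hℓm.trans hm2), hm3⟩

end Window

/-! ## §3. The root map on the window: rational endpoint bounds -/

/-- **Chord bound for an affine function**: `β + αℓ < M` and `β + αm < M` give `β + αt < M` on `(ℓ, m)`.
[folklore] -/
theorem affine_lt_of_mem_Ioo {ℓ m t α β M : ℝ} (hℓ : ℓ < t) (hm : t < m) (h1 : β + α * ℓ < M)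
    (h2 : β + α * m < M) : β + α * t < M := by
  have key : (m - ℓ) * (M - (β + α * t)) =
      (m - t) * (M - (β + α * ℓ)) + (t - ℓ) * (M - (β + α * m)) := by ring
  have hpos : 0 < (m - t) * (M - (β + α * ℓ)) + (t - ℓ) * (M - (β + α * m)) :=
    add_pos (mul_pos (by linarith) (by linarith)) (mul_pos (by linarith) (by linarith))
  rw [← key] at hpos
  have hmℓ : 0 < m - ℓ := by linarith
  have := (mul_pos_iff_of_pos_left hmℓ).1 hpos
  linarith

/-- **A convex parabola stays below its chord**: for `0 ≤ q₂` and `t ∈ (ℓ, m)`,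
`q₀ + q₁t + q₂t² < M` as soon as the chord endpoints `(q₀ − q₂ℓm) + (q₁ + q₂(ℓ+m))·ℓ` and `·m` are `< M`
(indeed `t² < (ℓ+m)t − ℓm` on the window). RATIONAL certificate, decided per class by `norm_num`. [folklore] -/
theorem quad_lt_of_mem_Ioo_of_nonneg {ℓ m t q₀ q₁ q₂ M : ℝ} (hℓ : ℓ < t) (hm : t < m) (hq₂ : 0 ≤ q₂)
    (h1 : q₀ - q₂ * ℓ * m + (q₁ + q₂ * (ℓ + m)) * ℓ < M)
    (h2 : q₀ - q₂ * ℓ * m + (q₁ + q₂ * (ℓ + m)) * m < M) :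
    q₀ + q₁ * t + q₂ * t ^ 2 < M := by
  have ht2 : t ^ 2 ≤ (ℓ + m) * t - ℓ * m := by nlinarith [mul_pos (sub_pos.2 hℓ) (sub_pos.2 hm)]
  have hq : q₂ * t ^ 2 ≤ q₂ * ((ℓ + m) * t - ℓ * m) := mul_le_mul_of_nonneg_left ht2 hq₂
  have haff := affine_lt_of_mem_Ioo (α := q₁ + q₂ * (ℓ + m)) (β := q₀ - q₂ * ℓ * m) hℓ hm h1 h2
  nlinarith

/-- **A concave parabola stays below its tangent at the midpoint**: for `q₂ ≤ 0`, `c = (ℓ+m)/2` and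
`t ∈ (ℓ, m)`, `q₀ + q₁t + q₂t² < M` as soon as `(q₀ − q₂c²) + (q₁ + 2q₂c)·ℓ` and `·m` are `< M` (indeed
`t² ≥ 2ct − c²`). RATIONAL certificate, decided per class by `norm_num`. [folklore] -/
theorem quad_lt_of_mem_Ioo_of_nonpos {ℓ m t q₀ q₁ q₂ M : ℝ} (hℓ : ℓ < t) (hm : t < m) (hq₂ : q₂ ≤ 0)
    (h1 : q₀ - q₂ * ((ℓ + m) / 2) ^ 2 + (q₁ + 2 * q₂ * ((ℓ + m) / 2)) * ℓ < M)
    (h2 : q₀ - q₂ * ((ℓ + m) / 2) ^ 2 + (q₁ + 2 * q₂ * ((ℓ + m) / 2)) * m < M) :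
    q₀ + q₁ * t + q₂ * t ^ 2 < M := by
  set c : ℝ := (ℓ + m) / 2 with hc
  have ht2 : 2 * c * t - c ^ 2 ≤ t ^ 2 := by nlinarith [sq_nonneg (t - c)]
  have hq : q₂ * t ^ 2 ≤ q₂ * (2 * c * t - c ^ 2) := mul_le_mul_of_nonpos_left ht2 hq₂
  have haff := affine_lt_of_mem_Ioo (α := q₁ + 2 * q₂ * c) (β := q₀ - q₂ * c ^ 2) hℓ hm h1 h2
  nlinarith

end Summit.BirchSwinnertonDyer.BirchSwinnertonDyer.Theorems.MultIrredTransportAtTwo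

end
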